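import Literature.NumberTheory.Automorphic.MeyerRatTheta
import HarnessLib

/-!
# Meyer's global difference representation — proofs, `K = ℚ`: the logarithmic coordinate on `C_ℚ`

Topic `NumberTheory/Automorphic`; namespace `Literature.NumberTheory.Automorphic.Meyer`. Sibling
PROOF file of `MeyerDifferenceRepresentation` (Step B/N5 of the plan for
`Meyer.spectralRealisation_rat` [Meyer2005, Thm. 5.11]: transfer of the Bruhat–Schwartz conditions
on `C_ℚ/𝒪̂ˣ ≅ ℝ_{>0} ≅ ℝ` to conditions on functions of one real variable). For `K = ℚ`,
`C_ℚ/𝒪̂ˣ ≅ ℝ_{>0}` [Meyer2005, §1 p. 3] and an `𝒪̂ˣ`-invariant ("unramified") function `f` on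
`C_ℚ` is the function `φ(y) = f([z(e^y)])` of `y = log |x| ∈ ℝ` (`MeyerRatStructure`). We prove
that `f` is Bruhat–Schwartz in the sense of `Meyer.IsIdeleClassSchwartz` (open stabiliser,
smoothness along the archimedean one-parameter group, decay of all archimedean derivatives against
the weights `(1 + |log|x||)^β`, [Meyer2005, §4.1 and proof of Lemma 5.2]) **iff `φ` is smooth with
`sup_y (1+|y|)^β ‖φ^{(n)}(y)‖ < ∞` for all `n, β`** — i.e. iff `φ ∈ 𝒮(ℝ)`:

* `Meyer.posClass y = [z(e^y)] ∈ C_ℚ` (**definition**), a one-parameter group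
  (`posClass_add`, `posClass_zero`) with `|posClass y| = e^y`; `apply_eq_apply_posClass_log` —
  an unramified `f` is `f(x) = φ(log |x|)`;
* `Meyer.mixedSpaceIsometryReal : mixedSpace ℚ ≃ₗᵢ[ℝ] ℝ` (**definition**; the equivalence
  `mixedSpaceEquivReal` of `MeyerRatTheta` is isometric for Mathlib's sup norms);
* `archExpClass_eq_posClass` — Meyer's archimedean direction `exp X` is `posClass (X_{∞})`;
  `archOrbit_eq_comp_of_unramified` — `X ↦ f(x · exp X)` is `φ(log|x| + ·)` read through the
  isometry; `norm_iteratedFDeriv_archOrbit_of_unramified` —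
  `‖Dⁿ_X f(x·exp X)|₀‖ = ‖φ⁽ⁿ⁾(log |x|)‖`;
* **`isIdeleClassSchwartz_iff_of_unramified`** — the transfer theorem above;
  `weightMul_posClass` — `(f·|x|^α)([z(e^y)]) = φ(y) e^{αy}`, so that `f ∈ H₋ = 𝒮(C_ℚ)_ℝ` iff
  `e^{αy} φ(y) ∈ 𝒮(ℝ)`-bounds hold for every `α` (`mem_Hminus_iff_of_unramified`).

Everything is proved; two definitions, no named facts.

## References

* R. Meyer, *On a representation of the idele class group related to primes and zeros of
  L-functions*, Duke Math. J. 127 (2005) = arXiv:math/0311468, §1 p. 3, §4.1, Lemma 5.2 (proof)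
  [Meyer2005].
-/

noncomputable section

open NumberField NumberField.InfinitePlace NumberField.mixedEmbedding IsDedekindDomain
open scoped NNReal ContDiff Classical

namespace Literature.NumberTheory.Automorphic.Meyer

open Literature.NumberTheory.GaloisRepresentations

/-! ### The one-parameter group `y ↦ [z(e^y)]` -/

section PosClass

/-- `e^y` as a unit of `ℝ≥0`. [folklore] -/
theorem exp_nnreal_ne_zero (y : ℝ) : (⟨Real.exp y, (Real.exp_pos y).le⟩ : ℝ≥0) ≠ 0 :=
  (show (0 : ℝ≥0) < ⟨Real.exp y, (Real.exp_pos y).le⟩ from Real.exp_pos y).ne'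

/-- **The positive real idele classes as a function of `y = log t`**: `posClass y = [z(e^y)]`, the
class of the diagonal positive real idele `z(e^y)` of `ℚ` (`posRealIdele`). [cite: Meyer2005, §1 p. 3] -/
def posClass (y : ℝ) : IdeleClassGroup ℚ :=
  IdeleClassGroup.mk ℚ (posRealIdele ℚ (Units.mk0 ⟨Real.exp y, (Real.exp_pos y).le⟩ (exp_nnreal_ne_zero y)))

/-- Unfolding of `posClass`. [folklore] -/
theorem posClass_def (y : ℝ) : posClass y =
    IdeleClassGroup.mk ℚ (posRealIdele ℚ (Units.mk0 ⟨Real.exp y, (Real.exp_pos y).le⟩ (exp_nnreal_ne_zero y))) :=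
  rfl

/-- `y ↦ [z(e^y)]` is a homomorphism `(ℝ, +) → C_ℚ`. [folklore] -/
theorem posClass_add (y y' : ℝ) : posClass (y + y') = posClass y * posClass y' := by
  rw [posClass, posClass, posClass, ← map_mul, ← map_mul]
  congr 2
  refine Units.ext (NNReal.eq ?_)
  simp only [Units.val_mul, Units.val_mk0, NNReal.coe_mul, Real.exp_add]
  rfl

/-- `[z(e^0)] = 1`. [folklore] -/
theorem posClass_zero : posClass 0 = 1 := by
  have h := posClass_add 0 0
  rw [add_zero] at h
  calc posClass 0 = (posClass 0)⁻¹ * (posClass 0 * posClass 0) := by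
        rw [← mul_assoc, inv_mul_cancel, one_mul]
    _ = (posClass 0)⁻¹ * posClass 0 := by rw [← h]
    _ = 1 := inv_mul_cancel _

/-- `|1| = 1` in `ℝ`. [folklore] -/
theorem classNorm_one : classNorm ℚ 1 = 1 := by
  rw [classNorm, map_one, NNReal.coe_one]

/-- `|[z(e^y)]| = e^y`. [cite: Meyer2005, §1 p. 3] -/
theorem classNorm_posClass (y : ℝ) : classNorm ℚ (posClass y) = Real.exp y := by
  rw [posClass, classNorm_mk_posRealIdele]
  rfl

/-- `log |[z(e^y)]| = y`. [folklore] -/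
theorem log_classNorm_posClass (y : ℝ) : Real.log (classNorm ℚ (posClass y)) = y := by
  rw [classNorm_posClass, Real.log_exp]

/-- The weight `(1 + |log|x||)^β` at `[z(e^y)]` is `(1 + |y|)^β`. [cite: Meyer2005, Lemma 5.2 (proof)] -/
theorem logWeight_posClass (β : ℕ) (y : ℝ) : logWeight ℚ β (posClass y) = (1 + |y|) ^ β := by
  rw [logWeight, log_classNorm_posClass]

/-- `[z(|x|)] = posClass (log |x|)`. [folklore] -/
theorem posClass_log_classNorm (c : IdeleClassGroup ℚ) :
    posClass (Real.log (classNorm ℚ c)) =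
      IdeleClassGroup.mk ℚ (posRealIdele ℚ (Units.mk0 (IdeleClassGroup.norm ℚ c) (norm_ne_zero' c))) := by
  rw [posClass]
  congr 2
  refine Units.ext (NNReal.eq ?_)
  change Real.exp (Real.log (classNorm ℚ c)) = (IdeleClassGroup.norm ℚ c : ℝ)
  rw [Real.exp_log (classNorm_pos c)]

/-- **An unramified function on `C_ℚ` is a function of `log |x|`**: `f x = φ(log |x|)` with
`φ(y) = f [z(e^y)]`. [cite: Meyer2005, §1 p. 3] -/
theorem apply_eq_apply_posClass_log {E : Type*} {f : IdeleClassGroup ℚ → E}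
    (hf : ∀ u ∈ integralFiniteUnits ℚ, ∀ x, f (x * finiteUnitClass ℚ u) = f x) (c : IdeleClassGroup ℚ) :
    f c = f (posClass (Real.log (classNorm ℚ c))) := by
  rw [posClass_log_classNorm]
  exact apply_eq_of_unramified hf c

/-- `posClass` is unaffected by `𝒪̂ˣ`-averaging: invariance of `f` gives
`f (posClass y * finiteUnitClass u) = f (posClass y)`. [folklore] -/
theorem posClass_mul_isUnramified {E : Type*} {f : IdeleClassGroup ℚ → E}
    (hf : ∀ u ∈ integralFiniteUnits ℚ, ∀ x, f (x * finiteUnitClass ℚ u) = f x)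
    (c : IdeleClassGroup ℚ) (y : ℝ) : f (c * posClass y) = f (posClass (Real.log (classNorm ℚ c) + y)) := by
  rw [apply_eq_apply_posClass_log hf (c * posClass y), classNorm_mul, Real.log_mul (classNorm_ne_zero c)
    (classNorm_ne_zero _), log_classNorm_posClass]

end PosClass

/-! ### `ℚ ⊗ ℝ = ℝ` isometrically, and the archimedean direction -/

section Arch

/-- The sup norm of `X ∈ ℝ^{1} × ℂ^{0}` is `|X_∞|`. [folklore] -/
theorem norm_mixedSpace_eq (X : mixedSpace ℚ) : ‖X‖ = ‖mixedSpaceEquivReal X‖ := by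
  rw [Prod.norm_def, mixedSpaceEquivReal_apply]
  have h2 : ‖X.2‖ = 0 := by
    have : X.2 = 0 := funext fun w => absurd w.2 (Rat.not_isComplex w.1)
    rw [this, norm_zero]
  have h1 : ‖X.1‖ = ‖X.1 ⟨Rat.infinitePlace, Rat.isReal_infinitePlace⟩‖ := by
    refine le_antisymm ?_ (norm_le_pi_norm _ _)
    refine (pi_norm_le_iff_of_nonneg (norm_nonneg _)).mpr fun w => ?_
    rw [Rat.eq_realPlace w]
  rw [h2, h1, max_eq_left (norm_nonneg _)]

/-- **`ℚ ⊗ ℝ = ℝ` isometrically**: `mixedSpaceEquivReal` as a linear isometry equivalence (for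
Mathlib's sup norms on `mixedSpace ℚ = ℝ^{1} × ℂ^{0}`). [folklore] -/
def mixedSpaceIsometryReal : mixedSpace ℚ ≃ₗᵢ[ℝ] ℝ :=
  { mixedSpaceEquivReal.toLinearEquiv with norm_map' := fun X => (norm_mixedSpace_eq X).symm }

/-- Unfolding: the isometry is `mixedSpaceEquivReal`. [folklore] -/
@[simp]
theorem mixedSpaceIsometryReal_apply (X : mixedSpace ℚ) : mixedSpaceIsometryReal X = mixedSpaceEquivReal X := rfl

/-- `exp X ∈ K_∞ˣ` for `K = ℚ` is the diagonal positive scalar `e^{X_∞}`. [folklore] -/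
theorem val_mixedExpUnit_eq (X : mixedSpace ℚ) :
    ((mixedExpUnit ℚ X : (mixedSpace ℚ)ˣ) : mixedSpace ℚ) =
      algebraMap ℝ (mixedSpace ℚ) (Real.exp (mixedSpaceEquivReal X)) := by
  refine Prod.ext (funext fun w => ?_) (funext fun w => absurd w.2 (Rat.not_isComplex w.1))
  rw [Rat.eq_realPlace w]
  rfl

/-- **Meyer's archimedean direction is the one-parameter group `posClass`**:
`[exp X] = posClass (X_∞)` for `K = ℚ`. [cite: Meyer2005, §4.1] -/
theorem archExpClass_eq_posClass (X : mixedSpace ℚ) : archExpClass ℚ X = posClass (mixedSpaceEquivReal X) := by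
  rw [archExpClass, posClass]
  congr 1
  refine Units.ext (Prod.ext ?_ ?_)
  · rw [infiniteIdeles_fst, posRealIdele_fst]
    change (InfiniteAdeleRing.ringEquiv_mixedSpace ℚ).symm ((mixedExpUnit ℚ X : (mixedSpace ℚ)ˣ) : mixedSpace ℚ) =
      (InfiniteAdeleRing.ringEquiv_mixedSpace ℚ).symm (algebraMap ℝ (mixedSpace ℚ) _)
    rw [val_mixedExpUnit_eq]
    rfl
  · rw [posRealIdele_snd]
    rfl

/-- **The archimedean orbit map of an unramified function is a translate of `φ`**:
`X ↦ f(x · exp X)` is `φ(log |x| + X_∞)`, `φ(y) = f [z(e^y)]`. [cite: Meyer2005, §4.1] -/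
theorem archOrbit_eq_comp_of_unramified {f : IdeleClassGroup ℚ → ℂ}
    (hf : ∀ u ∈ integralFiniteUnits ℚ, ∀ x, f (x * finiteUnitClass ℚ u) = f x) (c : IdeleClassGroup ℚ) :
    archOrbit ℚ f c = (fun z : ℝ => f (posClass (Real.log (classNorm ℚ c) + z))) ∘ mixedSpaceIsometryReal := by
  funext X
  rw [archOrbit, archExpClass_eq_posClass, posClass_mul_isUnramified hf, Function.comp_apply,
    mixedSpaceIsometryReal_apply]

/-- **`‖Dⁿ_X f(x · exp X)|_{X=0}‖ = ‖φ⁽ⁿ⁾(log |x|)‖`** for an unramified `f` (composition with a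
translation and a linear isometry). [cite: Meyer2005, §4.1] -/
theorem norm_iteratedFDeriv_archOrbit_of_unramified {f : IdeleClassGroup ℚ → ℂ}
    (hf : ∀ u ∈ integralFiniteUnits ℚ, ∀ x, f (x * finiteUnitClass ℚ u) = f x) (c : IdeleClassGroup ℚ) (n : ℕ) :
    ‖iteratedFDeriv ℝ n (archOrbit ℚ f c) 0‖ =
      ‖iteratedFDeriv ℝ n (fun y : ℝ => f (posClass y)) (Real.log (classNorm ℚ c))‖ := by
  rw [archOrbit_eq_comp_of_unramified hf c, LinearIsometryEquiv.norm_iteratedFDeriv_comp_right, map_zero]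
  have key : iteratedFDeriv ℝ n (fun z : ℝ => f (posClass (Real.log (classNorm ℚ c) + z))) =
      fun x => iteratedFDeriv ℝ n (fun y : ℝ => f (posClass y)) (Real.log (classNorm ℚ c) + x) :=
    iteratedFDeriv_comp_add_left' (f := fun y : ℝ => f (posClass y)) n (Real.log (classNorm ℚ c))
  rw [key]
  simp only [add_zero]

/-- The archimedean orbit maps of an unramified `f` are smooth iff `φ` is. [cite: Meyer2005, §4.1] -/
theorem contDiff_archOrbit_of_unramified {f : IdeleClassGroup ℚ → ℂ}
    (hf : ∀ u ∈ integralFiniteUnits ℚ, ∀ x, f (x * finiteUnitClass ℚ u) = f x)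
    (hφ : ContDiff ℝ ∞ (fun y : ℝ => f (posClass y))) (c : IdeleClassGroup ℚ) : ContDiff ℝ ∞ (archOrbit ℚ f c) := by
  rw [archOrbit_eq_comp_of_unramified hf c]
  refine ContDiff.comp ?_ mixedSpaceIsometryReal.toContinuousLinearEquiv.contDiff
  exact hφ.comp (contDiff_const.add contDiff_id)

end Arch

/-! ### The transfer theorem -/

section Transfer

/-- `𝒪̂ˣ` is open in the finite idele units (local copy of
`Meyer.isOpen_integralFiniteUnits` of `MeyerSummationSchwartz`, which is not imported here to keep
this file off the Eisenstein-majorant cone). [folklore] -/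
private theorem isOpen_integralFiniteUnits_aux (K : Type) [Field K] [NumberField K] :
    IsOpen (integralFiniteUnits K : Set (FiniteAdeleRing (𝓞 K) K)ˣ) := by
  have h1 : Continuous fun u : (FiniteAdeleRing (𝓞 K) K)ˣ => (u : FiniteAdeleRing (𝓞 K) K) := Units.continuous_val
  have h2 : Continuous fun u : (FiniteAdeleRing (𝓞 K) K)ˣ => ((u⁻¹ : (FiniteAdeleRing (𝓞 K) K)ˣ) : FiniteAdeleRing (𝓞 K) K) :=
    Units.continuous_coe_inv
  have hO := isOpen_integralFiniteAdeles K
  convert (hO.preimage h1).inter (hO.preimage h2) using 1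
  ext u
  simp only [Set.mem_inter_iff, Set.mem_preimage, SetLike.mem_coe]
  exact ⟨fun h => ⟨fun v => (h v).1, fun v => (h v).2⟩, fun h v => ⟨h.1 v, h.2 v⟩⟩

/-- **Transfer theorem** [Meyer2005, §4.1 with §1 p. 3 (`C_ℚ/𝒪̂ˣ ≅ ℝ`)]: an `𝒪̂ˣ`-invariant
function `f` on `C_ℚ` is Bruhat–Schwartz (`IsIdeleClassSchwartz`) iff `φ(y) = f [z(e^y)]` is smooth
and `sup_y (1+|y|)^β ‖φ⁽ⁿ⁾(y)‖ < ∞` for all `n, β ∈ ℕ` (i.e. `φ ∈ 𝒮(ℝ)`). [cite: Meyer2005, §4.1] -/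
theorem isIdeleClassSchwartz_iff_of_unramified {f : IdeleClassGroup ℚ → ℂ}
    (hf : ∀ u ∈ integralFiniteUnits ℚ, ∀ x, f (x * finiteUnitClass ℚ u) = f x) :
    IsIdeleClassSchwartz ℚ f ↔
      ContDiff ℝ ∞ (fun y : ℝ => f (posClass y)) ∧
        ∀ n β : ℕ, ∃ C : ℝ, ∀ y : ℝ, (1 + |y|) ^ β * ‖iteratedFDeriv ℝ n (fun y : ℝ => f (posClass y)) y‖ ≤ C := by
  constructor
  · intro hS
    have hφ : (fun y : ℝ => f (posClass y)) = archOrbit ℚ f 1 ∘ mixedSpaceIsometryReal.symm := by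
      funext y
      rw [Function.comp_apply, archOrbit_eq_comp_of_unramified hf 1, Function.comp_apply,
        LinearIsometryEquiv.apply_symm_apply, classNorm_one, Real.log_one, zero_add]
    refine ⟨?_, fun n β => ?_⟩
    · rw [hφ]
      exact (hS.contDiff 1).comp mixedSpaceIsometryReal.symm.toContinuousLinearEquiv.contDiff
    · obtain ⟨C, hC⟩ := hS.decay n β
      refine ⟨C, fun y => ?_⟩
      have h := hC (posClass y)
      rwa [logWeight_posClass, norm_iteratedFDeriv_archOrbit_of_unramified hf, log_classNorm_posClass] at h
  · rintro ⟨hφ, hb⟩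
    refine ⟨⟨⟨integralFiniteUnits ℚ, isOpen_integralFiniteUnits_aux ℚ⟩, fun u hu x => hf u hu x⟩,
      contDiff_archOrbit_of_unramified hf hφ, fun n β => ?_⟩
    obtain ⟨C, hC⟩ := hb n β
    refine ⟨C, fun c => ?_⟩
    rw [norm_iteratedFDeriv_archOrbit_of_unramified hf, logWeight]
    exact hC _

/-- `(f · |x|^α)([z(e^y)]) = f([z(e^y)]) e^{αy}`. [cite: Meyer2005, Def. 4.1] -/
theorem weightMul_posClass (α : ℝ) (f : IdeleClassGroup ℚ → ℂ) (y : ℝ) :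
    weightMul ℚ α f (posClass y) = f (posClass y) * (Real.exp (α * y) : ℂ) := by
  rw [weightMul_apply, classNorm_posClass, ← Real.exp_mul, mul_comm y]

/-- Weights preserve `𝒪̂ˣ`-invariance. [folklore] -/
theorem weightMul_isUnramified {α : ℝ} {f : IdeleClassGroup ℚ → ℂ}
    (hf : ∀ u ∈ integralFiniteUnits ℚ, ∀ x, f (x * finiteUnitClass ℚ u) = f x) :
    ∀ u ∈ integralFiniteUnits ℚ, ∀ x, weightMul ℚ α f (x * finiteUnitClass ℚ u) = weightMul ℚ α f x := by
  intro u hu x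
  rw [weightMul_apply, weightMul_apply, hf u hu x, classNorm_mul, classNorm_finiteUnitClass hu, mul_one]

/-- **`f ∈ H₋` on the `φ`-side**: an `𝒪̂ˣ`-invariant `f` lies in `H₋ = 𝒮(C_ℚ)_ℝ` iff for every real
`α` the function `y ↦ f([z(e^y)]) e^{αy}` is smooth with `sup_y (1+|y|)^β ‖∂ⁿ(f([z(e^y)]) e^{αy})‖ < ∞`
for all `n, β`. [cite: Meyer2005, §1 (1.2)] -/
theorem mem_Hminus_iff_of_unramified {f : IdeleClassGroup ℚ → ℂ}
    (hf : ∀ u ∈ integralFiniteUnits ℚ, ∀ x, f (x * finiteUnitClass ℚ u) = f x) :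
    f ∈ Hminus ℚ ↔ ∀ α : ℝ,
      ContDiff ℝ ∞ (fun y : ℝ => f (posClass y) * (Real.exp (α * y) : ℂ)) ∧
        ∀ n β : ℕ, ∃ C : ℝ, ∀ y : ℝ,
          (1 + |y|) ^ β * ‖iteratedFDeriv ℝ n (fun y : ℝ => f (posClass y) * (Real.exp (α * y) : ℂ)) y‖ ≤ C := by
  rw [Hminus, mem_ideleClassSchwartzWeighted_iff]
  simp only [Set.mem_univ, true_implies, mem_ideleClassSchwartz_iff]
  refine forall_congr' fun α => ?_
  rw [isIdeleClassSchwartz_iff_of_unramified (weightMul_isUnramified hf)]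
  simp only [weightMul_posClass]

end Transfer

end Literature.NumberTheory.Automorphic.Meyer
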